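import Summits.QuantumFields.YangMills.Theorems.BalabanUVNodesN15KingModelFullPropagatorMixedPowerLaw
import Summits.QuantumFields.YangMills.Theorems.BalabanUVNodesN15KingModelFullPropagatorOperatorEntries
import Summits.QuantumFields.YangMills.Theorems.BalabanUVNodesN15KingModelFullPropagatorRatePowerLaw

/-!
# BalabanUVNodes ∕ N15 — THE KING-MODEL RUNG, CURVED EDITION (PART V-b): [B9] (3.44) AT `U ≡ 1` — THE SUP ENTRY `|(∇_μ′A₀⁻¹∇*_μλ)(x)|` OF THE MIXED
# OBJECT FOR KING'S FULL `A = 0` PROPAGATOR, WITH THE HÖLDER NORM OF THE SOURCE: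
# `|(∇_μ′A₀⁻¹∇*_μλ)(x)| ≤ C(ε)·H·e^{−δ·|B(x) − B₀|}` for `λ` supported in the unit block `B₀` with `|λ(y) − λ(y′)| ≤ H·(|y − y′|∕N)^ε`,
# UNIFORMLY in `K`, the volume and the mass
# (Track A, DAG node N15 = NE2; FAN-OUT v1.1 §N15 s3 «KING-MODEL RUNG … + the one-line statement of what the curved case adds»)

HONEST FRAMING.  Count-neutral kernel bookkeeping (cell `pub-ymgap`, seat `pub-ymgap-dag-n15-e` g9; `--supports stmt-QuantumFields-20544
--as helper` = K3⁷ `SpineGivenEndpointR13SepCoPH`, WORDS-143).  TEMPLATE LITERATURE, `A = 0`: C. King's scalar U(1)-Higgs MODEL on finite tori ([King1986]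
(2.13) p. 653, Prop. 3.7 (3.63) p. 663 with `|a| = |b| = 1`), NOT Bałaban's covariant objects.  [Balaban1985BackgroundPropagators] Thm 3.1 p. 398
prints (3.44): «`|(∇_UG∇*_Uλ)(x)| ≤ B′₀(ε)exp(−δ₀d(y, y′))(ξ′^ε‖λ‖_ε + |λ|)` for `0 < ε ≤ 1`, `x ∈ Δ(y)`, `supp λ ⊂ Δ̃(y′)`» (tree `B9.KernelFamily.e4`,
`B9.Ineq343_345` clause 2) — the one sup entry of Theorem 3.1 that carries the HÖLDER norm of the source.  The statement below is that display for
King's full `A = 0` propagator `A₀⁻¹ = G_K(T_ε, 0)` at `U ≡ 1` with a ONE-block source, decided in the MODEL; it is NOT the printed proposition (which is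
for the covariant `G(U)` over the live window `Reg335` and the multiscale carrier), NE2⁺ is NOT PRINTED and not proved here; NOT a node discharge;
nothing continuum ∕ ℝ⁴ ∕ OS ∕ mass-gap ∕ Clay.  0 `sorry`, 0 `def`, standard axioms.

WHY (3.44) CARRIES `‖λ‖_ε` — AND THE PROOF.  By part Q4a (`inv_mulVec_adjDeriv_eq_sum`, summation by parts + symmetry) the operator `A₀⁻¹∇*_μ` is the
transposed-gradient kernel; one more η-difference in the observation point gives (§1 `inv_deriv_adjDeriv_eq_sum`)
`(∇_μ′A₀⁻¹∇*_μλ)(x) = Σ_y N^{−(d+1)}·DD_{μμ′}G(y, x)·λ(y)`, with the MIXED second difference of parts V-a, whose kernel is `≍ |x − y|^{−(d+1)}`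
(`fullPropDD_powerLaw_unif`) — a Calderón–Zygmund-size kernel, log-divergent in `ℓ¹` over the unit cube: against a merely bounded `λ` the sup entry
is NOT uniform in `η`.  The cancellation `Σ_y DD_{μμ′}G(y, x) = 0` (§1 `sum_mixedKernel_eq_zero`: the sum of a forward difference over the torus vanishes)
trades `λ(y)` for `λ(y) − λ(x)`, and the Hölder continuity `|λ(y) − λ(x)| ≤ H(|x − y|∕N)^ε` then pays, at level `i` of the profile
`C·Σ_{i<K}(L^{d+1})^i e^{−δ r L^i∕N}` (V-a `fullPropDD_profile_decay_unif`), exactly `(L^{−ε})^i`: the level-`i` exponential lives on the scale `N∕L^i` fine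
points, so `(r∕N)^ε e^{−δ r L^i∕N} ≲ (L^i)^{−ε} e^{−δ r L^i∕2N}` (§2 `rpow_mul_exp_neg_scale_le`) and `Σ_y e^{−κ r}` at `κ = δL^i∕2N` is `≤ (8(d+1)N∕(δL^i))^{d+1}`
(§2 `latticeConst_le_of_le`: the tree's `tdistT_sumBound` with its constant made explicit for small rates), which the prefactors `N^{−(d+1)}(L^{d+1})^i`
absorb; the geometric series in `L^{−ε}` closes uniformly in `K`, the volume and the mass.
* §1 `inv_deriv_adjDeriv_eq_sum`, `sum_mixedKernel_eq_zero`; §2 `latticeConst_le_of_le`, `rpow_mul_exp_neg_scale_le`, `levelShell_sum_le`;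
* §3 ★★★ **`fullPropMixedOp_holder_le`** — `0 < ε ≤ 1`: `∃ C δ > 0 ∀ K ≥ 1 ∀ N = L^K ∀ cube 2L^e ∀ 0 < m² ≤ m₀² ∀ μ μ′ ∀ λ, H ≥ 0, B₀` with
  `supp λ ⊂ B₀` (one unit block) and `|λ(y) − λ(y′)| ≤ H·(|y − y′|∕N)^ε` (all `y, y′`), `∀ x`:
  `|N·((A₀⁻¹∇*_μλ)(x + e_μ′) − (A₀⁻¹∇*_μλ)(x))| ≤ C·H·exp(−δ·|B(x) − B₀|_M)`, `(∇*_μλ)(y) = N(λ(y − e_μ) − λ(y))`.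
WHAT THE CURVED CASE ADDS (one line): (3.44) itself — the same for `∇_UG(U)∇*_U` uniformly over `Reg335`, multiscale sites, analyticity in `U` (Thm 3.4).
HONEST SCOPE.  (i) `A = 0`, periodic b.c., odd `L ≥ 3`, cubes `2L^e`, `K ≥ 1`, `0 < m² ≤ m₀²`; (ii) King's spelling of `A₀`; forward η-differences;
(iii) ONE-block sources at the unit scale (`ξ′ = 1`); the Hölder modulus in unit coordinates of level `K` with the SUP torus distance; no `|λ|` term is
needed (it is dominated by `H` for a one-block source, but we simply assume the global Hölder bound); (iv) `0 < ε ≤ 1`; (v) not Bałaban's `G(U)`; not a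
discharge.
Locators: [Balaban1985BackgroundPropagators] Thm 3.1 (3.44) p. 398; [King1986] (2.13) p. 653, Prop. 3.7 (3.63) p. 663, (4.42)–(4.44) p. 675;
[Balaban1983RegularityDecay] Theorem (1.10) p. 573.
-/

noncomputable section

namespace Summit.QuantumFields.YangMills.BalabanUVNodes.N15KingModelRung.Curved

open Real Finset Matrix
open Literature.MathematicalPhysics.QuantumFieldTheory.Balaban1983to89 (Params)
open Literature.MathematicalPhysics.QuantumFieldTheory.Balaban1983to89.B4Sect5Proof (latticeConst)
open Literature.MathematicalPhysics.QuantumFieldTheory.Balaban1983to89.B5Prop11Plancherel (Tor fine unitVec)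
open Literature.MathematicalPhysics.QuantumFieldTheory.King1986 (aK aK_pos)
open Literature.MathematicalPhysics.QuantumFieldTheory.King1986.Torus (fineOp constrainedProp blockOf tdistT tdistT_nonneg tdistT_symm
  tdistT_self tdistT_sumBound)

variable {d : ℕ} (L : ℕ) [NeZero L]

/-! ## §1 The mixed object as a kernel sum, and the cancellation -/

omit [NeZero L] in
/-- **`∇_μ′A₀⁻¹∇*_μλ` AS A KERNEL SUM**: `N·((A₀⁻¹∇*_μλ)(x + e_μ′) − (A₀⁻¹∇*_μλ)(x)) = Σ_y N^{−(d+1)}·DD_{μμ′}G(y, x)·λ(y)` with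
`DD_{μμ′}G(y, x) = N·(N·[G(y + e_μ, x + e_μ′) − G(y, x + e_μ′)] − N·[G(y + e_μ, x) − G(y, x)])` — part Q4a's summation-by-parts representation
`inv_mulVec_adjDeriv_eq_sum` differenced in the observation point. [cite: Balaban1985BackgroundPropagators, (3.44) p.398 (object); King1986, (2.13) p.653] -/
theorem inv_deriv_adjDeriv_eq_sum (N : ℕ) [NeZero N] (M : Fin (d + 1) → ℕ) [∀ μ, NeZero (M μ)] (a c m2 : ℝ)
    (lam : Tor (fine N M) → ℝ) (x : Tor (fine N M)) (μ μ' : Fin (d + 1)) :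
    (N : ℝ) * (((fineOp N M a c m2)⁻¹ *ᵥ (fun y => (N : ℝ) * (lam (y - unitVec (fine N M) μ) - lam y))) (x + unitVec (fine N M) μ')
        - ((fineOp N M a c m2)⁻¹ *ᵥ (fun y => (N : ℝ) * (lam (y - unitVec (fine N M) μ) - lam y))) x)
      = ∑ y, ((N : ℝ) ^ (d + 1))⁻¹ * ((N : ℝ) * ((N : ℝ) * (constrainedProp N M a c m2 (y + unitVec (fine N M) μ) (x + unitVec (fine N M) μ')
            - constrainedProp N M a c m2 y (x + unitVec (fine N M) μ'))
          - (N : ℝ) * (constrainedProp N M a c m2 (y + unitVec (fine N M) μ) x - constrainedProp N M a c m2 y x))) * lam y := by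
  rw [inv_mulVec_adjDeriv_eq_sum, inv_mulVec_adjDeriv_eq_sum, ← Finset.sum_sub_distrib, Finset.mul_sum]
  refine Finset.sum_congr rfl fun y _ => ?_
  ring

omit [NeZero L] in
/-- **THE CANCELLATION** `Σ_y DD_{μμ′}G(y, x) = 0`: the mixed second difference is a forward η-difference IN THE SUMMATION VARIABLE of
`y ↦ N·[G(y, x + e_μ′) − G(y, x)]`, and the sum of a forward difference over the torus vanishes (translation of the summation variable).
[cite: Balaban1985BackgroundPropagators, (3.44) p.398 (why the Hölder norm of λ enters); King1986, (2.13) p.653] -/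
theorem sum_mixedKernel_eq_zero (N : ℕ) [NeZero N] (M : Fin (d + 1) → ℕ) [∀ μ, NeZero (M μ)] (a c m2 : ℝ)
    (x : Tor (fine N M)) (μ μ' : Fin (d + 1)) :
    ∑ y, (N : ℝ) * ((N : ℝ) * (constrainedProp N M a c m2 (y + unitVec (fine N M) μ) (x + unitVec (fine N M) μ')
            - constrainedProp N M a c m2 y (x + unitVec (fine N M) μ'))
          - (N : ℝ) * (constrainedProp N M a c m2 (y + unitVec (fine N M) μ) x - constrainedProp N M a c m2 y x)) = 0 := by
  set φ : Tor (fine N M) → ℝ := fun y => constrainedProp N M a c m2 y (x + unitVec (fine N M) μ') - constrainedProp N M a c m2 y x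
    with hφ
  have hshift : ∑ y, φ (y + unitVec (fine N M) μ) = ∑ y, φ y :=
    Equiv.sum_comp (Equiv.addRight (unitVec (fine N M) μ)) φ
  have hterm : ∀ y, (N : ℝ) * ((N : ℝ) * (constrainedProp N M a c m2 (y + unitVec (fine N M) μ) (x + unitVec (fine N M) μ')
            - constrainedProp N M a c m2 y (x + unitVec (fine N M) μ'))
          - (N : ℝ) * (constrainedProp N M a c m2 (y + unitVec (fine N M) μ) x - constrainedProp N M a c m2 y x))
        = (N : ℝ) ^ 2 * (φ (y + unitVec (fine N M) μ) - φ y) := by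
    intro y
    simp only [hφ]
    ring
  rw [Finset.sum_congr rfl fun y _ => hterm y, ← Finset.mul_sum, Finset.sum_sub_distrib, hshift, sub_self, mul_zero]

/-! ## §2 The lattice sum at a small rate, made explicit; the scale bound -/

omit [NeZero L] in
/-- **The tree's lattice-sum constant at a small rate**: `latticeConst dd κ = (2(1 − e^{−κ∕dd})⁻¹)^{dd} ≤ (4dd∕κ)^{dd}` for `0 < κ ≤ dd`
(`1 − e^{−t} ≥ t∕(1 + t) ≥ t∕2` for `0 < t ≤ 1`, from `1 + t ≤ e^t`). [cite: Balaban1983RegularityDecay, §5 (5.7)–(5.8) p.594, proof pp.595–596 (the lattice sums behind c₁)] -/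
theorem latticeConst_le_of_le (dd : ℕ) (hdd : 1 ≤ dd) {κ : ℝ} (hκ : 0 < κ) (hκ1 : κ ≤ dd) :
    latticeConst dd κ ≤ (4 * (dd : ℝ) / κ) ^ dd := by
  have hdd0 : (0 : ℝ) < dd := by exact_mod_cast hdd
  set t : ℝ := κ / dd with htdef
  have ht0 : 0 < t := div_pos hκ hdd0
  have ht1 : t ≤ 1 := (div_le_one hdd0).mpr hκ1
  -- `e^{−t} ≤ 1∕(1 + t)`
  have hexp : Real.exp (-t) ≤ 1 / (1 + t) := by
    rw [Real.exp_neg, one_div]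
    exact inv_anti₀ (by linarith) (by linarith [Real.add_one_le_exp t])
  -- `1 − e^{−t} ≥ t∕2`
  have hlow : t / 2 ≤ 1 - Real.exp (-t) := by
    have h1 : 1 - 1 / (1 + t) = t / (1 + t) := by field_simp; ring
    have h2 : t / 2 ≤ t / (1 + t) := div_le_div_of_nonneg_left ht0.le (by linarith) (by linarith)
    linarith
  have hpos : 0 < 1 - Real.exp (-t) := lt_of_lt_of_le (by positivity) hlow
  have hinv : (1 - Real.exp (-t))⁻¹ ≤ 2 / t := by
    rw [show (2 : ℝ) / t = (t / 2)⁻¹ by rw [inv_div]]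
    exact inv_anti₀ (by positivity) hlow
  have hbase : 2 * (1 - Real.exp (-(κ / dd)))⁻¹ ≤ 4 * (dd : ℝ) / κ := by
    rw [← htdef]
    calc 2 * (1 - Real.exp (-t))⁻¹ ≤ 2 * (2 / t) := mul_le_mul_of_nonneg_left hinv (by norm_num)
      _ = 4 * (dd : ℝ) / κ := by rw [htdef]; field_simp; ring
  have hbase0 : 0 ≤ 2 * (1 - Real.exp (-(κ / dd)))⁻¹ := by
    rw [← htdef]; exact mul_nonneg (by norm_num) (inv_nonneg.mpr hpos.le)
  unfold latticeConst
  exact pow_le_pow_left₀ hbase0 hbase dd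

omit [NeZero L] in
/-- **The scale bound** `u^s·e^{−bu} ≤ 2·b^{−s}·e^{−(b∕2)u}` (`u ≥ 0`, `b > 0`, `0 ≤ s ≤ 1`; part S-b `rpow_mul_exp_neg_le` at `x = bu`). [folklore] -/
theorem rpow_mul_exp_neg_scale_le {u b s : ℝ} (hu : 0 ≤ u) (hb : 0 < b) (hs0 : 0 ≤ s) (hs1 : s ≤ 1) :
    u ^ s * Real.exp (-(b * u)) ≤ 2 * b ^ (-s) * Real.exp (-(b / 2 * u)) := by
  have h := rpow_mul_exp_neg_le (x := b * u) (mul_nonneg hb.le hu) hs0 hs1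
  rw [Real.mul_rpow hb.le hu] at h
  have hbs : 0 < b ^ s := Real.rpow_pos_of_pos hb s
  have e1 : u ^ s * Real.exp (-(b * u)) = b ^ (-s) * (b ^ s * u ^ s * Real.exp (-(b * u))) := by
    rw [Real.rpow_neg hb.le, ← mul_assoc, ← mul_assoc, inv_mul_cancel₀ hbs.ne', one_mul]
  rw [e1, show b / 2 * u = b * u / 2 by ring]
  calc b ^ (-s) * (b ^ s * u ^ s * Real.exp (-(b * u))) ≤ b ^ (-s) * (2 * Real.exp (-(b * u / 2))) :=
        mul_le_mul_of_nonneg_left h (Real.rpow_nonneg hb.le _)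
    _ = 2 * b ^ (-s) * Real.exp (-(b * u / 2)) := by ring

/-- **One level of the profile against the Hölder modulus**: on the fine torus `Tor (fine N M)` with `1 ≤ q ≤ N`, `0 < δ ≤ 1`, `0 ≤ ε ≤ 1`,
`Σ_y (|x − y|∕N)^ε·e^{−δ·|x − y|·q∕N} ≤ 2δ^{−ε}·q^{−ε}·(8(d+1)N∕(δq))^{d+1}` — the level-`i` exponential (`q = L^i`) lives on the scale `N∕q`, so the Hölder
weight pays `q^{−ε}` and the lattice sum `(N∕q)^{d+1}`. [cite: King1986, Prop. 3.7 (3.63) p.663 (the scale-`j` piece); Balaban1983RegularityDecay, §5 (5.7)–(5.8) p.594, proof pp.595–596] -/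
theorem levelShell_sum_le (N : ℕ) [NeZero N] (M : Fin (d + 1) → ℕ) [∀ μ, NeZero (M μ)] {q δ ε : ℝ} (hq1 : 1 ≤ q)
    (hqN : q ≤ N) (hδ0 : 0 < δ) (hδ1 : δ ≤ 1) (hε0 : 0 ≤ ε) (hε1 : ε ≤ 1) (x : Tor (fine N M)) :
    ∑ y, (tdistT (fine N M) x y / (N : ℝ)) ^ ε * Real.exp (-(δ * (tdistT (fine N M) x y * q / (N : ℝ))))
      ≤ 2 * δ ^ (-ε) * q ^ (-ε) * (8 * ((d : ℝ) + 1) * (N : ℝ) / (δ * q)) ^ (d + 1) := by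
  have hq0 : 0 < q := by linarith
  have hN0 : 0 < (N : ℝ) := by linarith
  set κ : ℝ := δ / 2 * (q / (N : ℝ)) with hκdef
  have hκ0 : 0 < κ := by positivity
  have hκ1 : κ ≤ ((d + 1 : ℕ) : ℝ) := by
    have h1 : q / (N : ℝ) ≤ 1 := (div_le_one hN0).mpr hqN
    have h2 : κ ≤ 1 / 2 * 1 := mul_le_mul (by linarith) h1 (by positivity) (by norm_num)
    have h3 : (1 : ℝ) ≤ ((d + 1 : ℕ) : ℝ) := by exact_mod_cast Nat.le_add_left 1 d
    linarith
  -- termwise: `(r∕N)^ε e^{−δ r q∕N} ≤ 2δ^{−ε} q^{−ε} e^{−κ r}`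
  have hterm : ∀ y, (tdistT (fine N M) x y / (N : ℝ)) ^ ε * Real.exp (-(δ * (tdistT (fine N M) x y * q / (N : ℝ))))
      ≤ 2 * δ ^ (-ε) * q ^ (-ε) * Real.exp (-(κ * tdistT (fine N M) x y)) := by
    intro y
    set r : ℝ := tdistT (fine N M) x y with hrdef
    have hr0 : 0 ≤ r := tdistT_nonneg _ x y
    set u : ℝ := r * q / (N : ℝ) with hudef
    have hu0 : 0 ≤ u := by positivity
    -- `(r∕N)^ε = q^{−ε}·u^ε`
    have hqε : q ^ ε ≠ 0 := (Real.rpow_pos_of_pos hq0 ε).ne'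
    have hw : (r / (N : ℝ)) ^ ε = q ^ (-ε) * u ^ ε := by
      have hu : u = (r / (N : ℝ)) * q := by rw [hudef]; ring
      rw [hu, Real.mul_rpow (div_nonneg hr0 hN0.le) hq0.le, Real.rpow_neg hq0.le, mul_left_comm,
        inv_mul_cancel₀ hqε, mul_one]
    have hscale := rpow_mul_exp_neg_scale_le hu0 hδ0 hε0 hε1
    have hκu : κ * r = δ / 2 * u := by rw [hκdef, hudef]; ring
    rw [hw, show δ * (r * q / (N : ℝ)) = δ * u by rw [hudef], mul_assoc, hκu]
    calc q ^ (-ε) * (u ^ ε * Real.exp (-(δ * u))) ≤ q ^ (-ε) * (2 * δ ^ (-ε) * Real.exp (-(δ / 2 * u))) :=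
          mul_le_mul_of_nonneg_left hscale (Real.rpow_nonneg hq0.le _)
      _ = 2 * δ ^ (-ε) * q ^ (-ε) * Real.exp (-(δ / 2 * u)) := by ring
  have hsum := tdistT_sumBound (fine N M) κ hκ0 x
  have hLC := latticeConst_le_of_le (d + 1) (by omega) hκ0 hκ1
  have hκinv : 4 * ((d + 1 : ℕ) : ℝ) / κ = 8 * ((d : ℝ) + 1) * (N : ℝ) / (δ * q) := by
    rw [hκdef]; push_cast; field_simp; ring
  rw [hκinv] at hLC
  calc ∑ y, (tdistT (fine N M) x y / (N : ℝ)) ^ ε * Real.exp (-(δ * (tdistT (fine N M) x y * q / (N : ℝ))))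
      ≤ ∑ y, 2 * δ ^ (-ε) * q ^ (-ε) * Real.exp (-(κ * tdistT (fine N M) x y)) := Finset.sum_le_sum fun y _ => hterm y
    _ = 2 * δ ^ (-ε) * q ^ (-ε) * ∑ y, Real.exp (-(κ * tdistT (fine N M) x y)) := by rw [Finset.mul_sum]
    _ ≤ 2 * δ ^ (-ε) * q ^ (-ε) * (8 * ((d : ℝ) + 1) * (N : ℝ) / (δ * q)) ^ (d + 1) :=
        mul_le_mul_of_nonneg_left (hsum.trans hLC) (by positivity)

/-! ## §3 (3.44) at `U ≡ 1` for King's full `A = 0` propagator -/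

/-- **[B9] (3.44) AT `U ≡ 1` FOR KING'S FULL `A = 0` FLUCTUATION PROPAGATOR — THE SUP ENTRY OF THE MIXED OBJECT WITH THE HÖLDER NORM OF THE SOURCE.**
For odd `L ≥ 3`, `a > 0`, a mass cap `m₀² ≥ 0` and `0 < ε ≤ 1` there are `C, δ > 0` (functions of `d, L, a, m₀², ε`) such that for EVERY `K ≥ 1` (spelling
`N = L^K`), cube `M_μ = 2L^e`, mass `0 < m² ≤ m₀²`, directions `μ, μ′`, every source `λ` on the fine torus supported in ONE unit block `B₀` and
ε-HÖLDER in unit coordinates, `|λ(y) − λ(y′)| ≤ H·(|y − y′|∕N)^ε` (`H ≥ 0`), and every fine point `x`: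
`|N·((A₀⁻¹∇*_μλ)(x + e_μ′) − (A₀⁻¹∇*_μλ)(x))| ≤ C·H·exp(−δ·|B(x) − B₀|_M)`, `(∇*_μλ)(y) = N(λ(y − e_μ) − λ(y))`, `A₀⁻¹ = (fineOp N M a_K N² m²)⁻¹` —
the printed shape «`|(∇_UG∇*_Uλ)(x)| ≤ B′₀(ε)exp(−δ₀d(y, y′))(ξ′^ε‖λ‖_ε + |λ|)`» at `U ≡ 1`, one-block sources, uniformly in `K`, the volume and the mass.
Proof: §1 (kernel sum + cancellation `λ(y) ↦ λ(y) − λ(x)`), part V-a `fullPropDD_profile_decay_unif` for the kernel at `(y, x)`, §2 level by level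
(factor `(L^{−ε})^i`), geometric series.  WHY the Hölder norm: the kernel is `≍ |x − y|^{−(d+1)}` (`fullPropDD_powerLaw_unif`), not `ℓ¹` uniformly in `η`.
[cite: Balaban1985BackgroundPropagators, Thm 3.1 (3.44) p.398; King1986, (2.13) p.653, Prop. 3.7 (3.63) p.663; Balaban1983RegularityDecay, Theorem (1.10) p.573] -/
theorem fullPropMixedOp_holder_le (hLodd : Odd L) (hL : 2 ≤ L) {a : ℝ} (ha : 0 < a) {m0sq : ℝ} (hm0 : 0 ≤ m0sq)
    {ε : ℝ} (hε0 : 0 < ε) (hε1 : ε ≤ 1) :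
    ∃ C δ : ℝ, 0 < C ∧ 0 < δ ∧ ∀ (K : ℕ), 1 ≤ K → ∀ (N : ℕ) [NeZero N], N = L ^ K →
      ∀ (e : ℕ) (M : Fin (d + 1) → ℕ) [∀ μ, NeZero (M μ)], (∀ μ, M μ = 2 * L ^ e) →
      ∀ (msq : ℝ), 0 < msq → msq ≤ m0sq → ∀ (μ μ' : Fin (d + 1)) (lam : Tor (fine N M) → ℝ) (H : ℝ) (B₀ : Tor M),
        0 ≤ H → (∀ y, lam y ≠ 0 → blockOf N M y = B₀) →
        (∀ y y', |lam y - lam y'| ≤ H * (tdistT (fine N M) y y' / (N : ℝ)) ^ ε) →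
        ∀ x : Tor (fine N M),
        |(N : ℝ) * (((fineOp N M (aK a L K) (((N : ℕ) : ℝ) ^ 2) msq)⁻¹
                *ᵥ (fun y => (N : ℝ) * (lam (y - unitVec (fine N M) μ) - lam y))) (x + unitVec (fine N M) μ')
            - ((fineOp N M (aK a L K) (((N : ℕ) : ℝ) ^ 2) msq)⁻¹
                *ᵥ (fun y => (N : ℝ) * (lam (y - unitVec (fine N M) μ) - lam y))) x)|
          ≤ C * H * Real.exp (-(δ * tdistT M (blockOf N M x) B₀)) := by
  have hL1 : 1 < L := by omega
  have hLr : (1 : ℝ) < L := by exact_mod_cast hL1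
  have hL0 : (0 : ℝ) < L := by linarith
  obtain ⟨C₀, δ₀, hC₀, hδ₀, HDD⟩ := fullPropDD_profile_decay_unif (d := d) L hLodd hL ha hm0
  -- the rate used inside the levels (`≤ 1` for the small-rate lattice sum) and the level factor `θ = L^{−ε} < 1`
  set δ₁ : ℝ := min δ₀ 1 with hδ₁def
  have hδ₁0 : 0 < δ₁ := lt_min hδ₀ one_pos
  have hδ₁δ : δ₁ ≤ δ₀ := min_le_left _ _
  have hδ₁1 : δ₁ ≤ 1 := min_le_right _ _
  set θ : ℝ := (L : ℝ) ^ (-ε) with hθdef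
  have hθ0 : 0 ≤ θ := Real.rpow_nonneg hL0.le _
  have hθ1 : θ < 1 := Real.rpow_lt_one_of_one_lt_of_neg hLr (by linarith)
  have h1θ : 0 < 1 - θ := sub_pos.mpr hθ1
  set A₁ : ℝ := 2 * δ₁ ^ (-ε) * (8 * ((d : ℝ) + 1) / δ₁) ^ (d + 1) with hA₁def
  have hA₁ : 0 < A₁ := by positivity
  refine ⟨C₀ * A₁ / (1 - θ), δ₀, div_pos (mul_pos hC₀ hA₁) h1θ, hδ₀, ?_⟩
  intro K hK N _ hN e M _ hM msq hmsq hcap μ μ' lam H B₀ hH0 hsupp hH x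
  have hN1 : (1 : ℝ) ≤ (N : ℝ) := by rw [hN]; exact_mod_cast Nat.one_le_pow K L (by omega)
  have hN0 : 0 < (N : ℝ) := by linarith
  have hNK : ((N : ℝ)) = (L : ℝ) ^ K := by rw [hN, Nat.cast_pow]
  set D₀ : ℝ := tdistT M (blockOf N M x) B₀ with hD₀def
  -- Step A: the kernel sum, the kernel as a named function, the cancellation
  rw [inv_deriv_adjDeriv_eq_sum]
  obtain ⟨DDk, hDDk⟩ : ∃ f : Tor (fine N M) → ℝ, ∀ y, f y
      = (N : ℝ) * ((N : ℝ) * (constrainedProp N M (aK a L K) (((N : ℕ) : ℝ) ^ 2) msq (y + unitVec (fine N M) μ) (x + unitVec (fine N M) μ')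
            - constrainedProp N M (aK a L K) (((N : ℕ) : ℝ) ^ 2) msq y (x + unitVec (fine N M) μ'))
          - (N : ℝ) * (constrainedProp N M (aK a L K) (((N : ℕ) : ℝ) ^ 2) msq (y + unitVec (fine N M) μ) x
            - constrainedProp N M (aK a L K) (((N : ℕ) : ℝ) ^ 2) msq y x)) := ⟨_, fun _ => rfl⟩
  rw [Finset.sum_congr rfl fun y _ => by rw [← hDDk y]]
  set c : ℝ := ((N : ℝ) ^ (d + 1))⁻¹ with hcdef
  have hc0 : 0 < c := by positivity
  have hcN : c * (N : ℝ) ^ (d + 1) = 1 := by rw [hcdef, inv_mul_cancel₀ (pow_ne_zero _ hN0.ne')]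
  have hsum0 : ∑ y, DDk y = 0 := by
    rw [Finset.sum_congr rfl fun y _ => hDDk y]
    exact sum_mixedKernel_eq_zero N M (aK a L K) (((N : ℕ) : ℝ) ^ 2) msq x μ μ'
  have hrepr : ∑ y, c * DDk y * lam y = ∑ y, c * DDk y * (lam y - lam x) := by
    have hx : ∑ y, c * DDk y * lam x = 0 := by
      rw [← Finset.sum_mul, ← Finset.mul_sum, hsum0, mul_zero, zero_mul]
    calc ∑ y, c * DDk y * lam y = ∑ y, (c * DDk y * (lam y - lam x) + c * DDk y * lam x) :=
          Finset.sum_congr rfl fun y _ => by ring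
      _ = ∑ y, c * DDk y * (lam y - lam x) + ∑ y, c * DDk y * lam x := Finset.sum_add_distrib
      _ = ∑ y, c * DDk y * (lam y - lam x) := by rw [hx, add_zero]
  rw [hrepr]
  -- the level sums at the rate `δ₁`, as a named function of the source point
  obtain ⟨S₁, hS₁⟩ : ∃ f : Tor (fine N M) → ℝ, ∀ y, f y = ∑ i ∈ Finset.range K, ((L : ℝ) ^ (d + 1) / (L : ℝ) ^ 2 * L * L) ^ i
      * Real.exp (-(δ₁ * (tdistT (fine N M) x y * (L : ℝ) ^ i / (N : ℝ)))) := ⟨_, fun _ => rfl⟩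
  have hS₁0 : ∀ y, 0 ≤ S₁ y := fun y => by rw [hS₁]; exact Finset.sum_nonneg fun i _ => by positivity
  -- Step B: termwise bound `|c·DD(y,x)·(λ(y) − λ(x))| ≤ c·C₀·H·e^{−δ₀D₀}·((|x−y|∕N)^ε·S₁(y))`
  have hterm : ∀ y, |c * DDk y * (lam y - lam x)|
      ≤ c * C₀ * H * Real.exp (-(δ₀ * D₀)) * ((tdistT (fine N M) x y / (N : ℝ)) ^ ε * S₁ y) := by
    intro y
    have hw0 : 0 ≤ (tdistT (fine N M) x y / (N : ℝ)) ^ ε := Real.rpow_nonneg (div_nonneg (tdistT_nonneg _ _ _) hN0.le) _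
    by_cases hyx : lam y = lam x
    · rw [hyx, sub_self, mul_zero, abs_zero]
      have := hS₁0 y
      positivity
    -- the profile with decay at `(y, x)` (part V-a)
    have hdd : |DDk y| ≤ C₀ * (∑ i ∈ Finset.range K, ((L : ℝ) ^ (d + 1) / (L : ℝ) ^ 2 * L * L) ^ i
          * Real.exp (-(δ₀ * (tdistT (fine N M) y x * (L : ℝ) ^ i / (N : ℝ)))))
        * Real.exp (-(δ₀ * tdistT M (blockOf N M y) (blockOf N M x))) := by
      rw [hDDk]
      exact HDD K hK N hN e M hM msq hmsq hcap μ μ' y x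
    -- the block decay read at `B₀`: either `λ(y) ≠ 0` (so `B(y) = B₀`) or `λ(x) ≠ 0` (so `B(x) = B₀`, `D₀ = 0`)
    have hdec : Real.exp (-(δ₀ * tdistT M (blockOf N M y) (blockOf N M x))) ≤ Real.exp (-(δ₀ * D₀)) := by
      by_cases hy0 : lam y = 0
      · have hx0 : lam x ≠ 0 := fun h => hyx (by rw [hy0, h])
        have hBx : blockOf N M x = B₀ := hsupp x hx0
        rw [hD₀def, hBx, tdistT_self, mul_zero, neg_zero, Real.exp_zero, Real.exp_le_one_iff]
        have := tdistT_nonneg M (blockOf N M y) B₀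
        nlinarith
      · rw [hsupp y hy0, hD₀def, tdistT_symm]
    -- the level exponentials at the rate `δ₁ ≤ δ₀`, the distance symmetrised
    have hprof : ∑ i ∈ Finset.range K, ((L : ℝ) ^ (d + 1) / (L : ℝ) ^ 2 * L * L) ^ i
          * Real.exp (-(δ₀ * (tdistT (fine N M) y x * (L : ℝ) ^ i / (N : ℝ)))) ≤ S₁ y := by
      rw [hS₁]
      refine Finset.sum_le_sum fun i _ => mul_le_mul_of_nonneg_left ?_ (by positivity)
      rw [tdistT_symm]
      apply Real.exp_le_exp.mpr
      have h0 : 0 ≤ tdistT (fine N M) x y * (L : ℝ) ^ i / (N : ℝ) := by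
        have := tdistT_nonneg (fine N M) x y; positivity
      nlinarith [mul_le_mul_of_nonneg_right hδ₁δ h0]
    have hHy : |lam y - lam x| ≤ H * (tdistT (fine N M) x y / (N : ℝ)) ^ ε := by
      have h := hH y x
      rwa [tdistT_symm] at h
    have hDD' : |DDk y| ≤ C₀ * S₁ y * Real.exp (-(δ₀ * D₀)) :=
      hdd.trans (mul_le_mul (mul_le_mul_of_nonneg_left hprof hC₀.le) hdec (Real.exp_pos _).le
        (mul_nonneg hC₀.le (hS₁0 y)))
    calc |c * DDk y * (lam y - lam x)| = c * |DDk y| * |lam y - lam x| := by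
          rw [abs_mul, abs_mul, abs_of_pos hc0]
      _ ≤ c * (C₀ * S₁ y * Real.exp (-(δ₀ * D₀))) * (H * (tdistT (fine N M) x y / (N : ℝ)) ^ ε) :=
          mul_le_mul (mul_le_mul_of_nonneg_left hDD' hc0.le) hHy (abs_nonneg _) (by have := hS₁0 y; positivity)
      _ = c * C₀ * H * Real.exp (-(δ₀ * D₀)) * ((tdistT (fine N M) x y / (N : ℝ)) ^ ε * S₁ y) := by ring
  -- Step C: the levels — `Σ_y (|x−y|∕N)^ε·S₁(y) ≤ A₁·N^{d+1}·Σ_i θ^i ≤ A₁·N^{d+1}∕(1 − θ)`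
  have hlevel : ∀ i ∈ Finset.range K, ((L : ℝ) ^ (d + 1) / (L : ℝ) ^ 2 * L * L) ^ i
      * ∑ y, (tdistT (fine N M) x y / (N : ℝ)) ^ ε * Real.exp (-(δ₁ * (tdistT (fine N M) x y * (L : ℝ) ^ i / (N : ℝ))))
        ≤ A₁ * (N : ℝ) ^ (d + 1) * θ ^ i := by
    intro i hi
    have hiK : i < K := Finset.mem_range.mp hi
    have hq1 : (1 : ℝ) ≤ (L : ℝ) ^ i := one_le_pow₀ hLr.le
    have hq0 : (0 : ℝ) < (L : ℝ) ^ i := by linarith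
    have hqN : (L : ℝ) ^ i ≤ (N : ℝ) := by rw [hNK]; exact pow_le_pow_right₀ hLr.le hiK.le
    have hS := levelShell_sum_le N M (q := (L : ℝ) ^ i) hq1 hqN hδ₁0 hδ₁1 hε0.le hε1 x
    have hΛ : ((L : ℝ) ^ (d + 1) / (L : ℝ) ^ 2 * L * L) ^ i = ((L : ℝ) ^ i) ^ (d + 1) := by
      rw [LamL2_eq_pow L hL, ← pow_mul, ← pow_mul, Nat.mul_comm]
    -- `(L^i)^{−ε} = θ^i`
    have hθq : ((L : ℝ) ^ i) ^ (-ε) = θ ^ i := by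
      rw [hθdef, ← Real.rpow_natCast (L : ℝ) i, ← Real.rpow_mul hL0.le, show ((i : ℕ) : ℝ) * -ε = -ε * (i : ℕ) by ring,
        Real.rpow_mul hL0.le, Real.rpow_natCast]
    -- `q^{d+1}·[2δ₁^{−ε}q^{−ε}(8(d+1)N∕(δ₁q))^{d+1}] = A₁·N^{d+1}·θ^i`
    have h8 : 8 * ((d : ℝ) + 1) * (N : ℝ) / (δ₁ * (L : ℝ) ^ i) = (8 * ((d : ℝ) + 1) / δ₁) * ((N : ℝ) / (L : ℝ) ^ i) :=
      (div_mul_div_comm _ _ _ _).symm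
    have halg : ((L : ℝ) ^ i) ^ (d + 1) * (2 * δ₁ ^ (-ε) * ((L : ℝ) ^ i) ^ (-ε)
          * (8 * ((d : ℝ) + 1) * (N : ℝ) / (δ₁ * (L : ℝ) ^ i)) ^ (d + 1))
        = A₁ * (N : ℝ) ^ (d + 1) * θ ^ i := by
      have hqd : ((L : ℝ) ^ i) ^ (d + 1) ≠ 0 := pow_ne_zero _ hq0.ne'
      have hδd : δ₁ ^ (d + 1) ≠ 0 := pow_ne_zero _ hδ₁0.ne'
      rw [hθq, h8, mul_pow, div_pow, div_pow, hA₁def, div_pow]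
      field_simp
    rw [hΛ]
    calc ((L : ℝ) ^ i) ^ (d + 1) * ∑ y, (tdistT (fine N M) x y / (N : ℝ)) ^ ε
            * Real.exp (-(δ₁ * (tdistT (fine N M) x y * (L : ℝ) ^ i / (N : ℝ))))
        ≤ ((L : ℝ) ^ i) ^ (d + 1) * (2 * δ₁ ^ (-ε) * ((L : ℝ) ^ i) ^ (-ε)
            * (8 * ((d : ℝ) + 1) * (N : ℝ) / (δ₁ * (L : ℝ) ^ i)) ^ (d + 1)) :=
          mul_le_mul_of_nonneg_left hS (by positivity)
      _ = A₁ * (N : ℝ) ^ (d + 1) * θ ^ i := halg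
  have hΦsum : ∑ y, (tdistT (fine N M) x y / (N : ℝ)) ^ ε * S₁ y ≤ A₁ * (N : ℝ) ^ (d + 1) * (1 / (1 - θ)) := by
    have hexpand : ∀ y, (tdistT (fine N M) x y / (N : ℝ)) ^ ε * S₁ y
        = ∑ i ∈ Finset.range K, ((L : ℝ) ^ (d + 1) / (L : ℝ) ^ 2 * L * L) ^ i
          * ((tdistT (fine N M) x y / (N : ℝ)) ^ ε * Real.exp (-(δ₁ * (tdistT (fine N M) x y * (L : ℝ) ^ i / (N : ℝ))))) := by
      intro y
      rw [hS₁, Finset.mul_sum]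
      exact Finset.sum_congr rfl fun i _ => by ring
    have hgeom : ∑ i ∈ Finset.range K, θ ^ i ≤ 1 / (1 - θ) := by
      have h := geom_sum_Ico_le_of_lt_one (m := 0) (n := K) hθ0 hθ1
      rwa [← Finset.range_eq_Ico, pow_zero] at h
    calc ∑ y, (tdistT (fine N M) x y / (N : ℝ)) ^ ε * S₁ y
        = ∑ y, ∑ i ∈ Finset.range K, ((L : ℝ) ^ (d + 1) / (L : ℝ) ^ 2 * L * L) ^ i
          * ((tdistT (fine N M) x y / (N : ℝ)) ^ ε * Real.exp (-(δ₁ * (tdistT (fine N M) x y * (L : ℝ) ^ i / (N : ℝ))))) :=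
          Finset.sum_congr rfl fun y _ => hexpand y
      _ = ∑ i ∈ Finset.range K, ∑ y, ((L : ℝ) ^ (d + 1) / (L : ℝ) ^ 2 * L * L) ^ i
          * ((tdistT (fine N M) x y / (N : ℝ)) ^ ε * Real.exp (-(δ₁ * (tdistT (fine N M) x y * (L : ℝ) ^ i / (N : ℝ))))) :=
          Finset.sum_comm
      _ = ∑ i ∈ Finset.range K, ((L : ℝ) ^ (d + 1) / (L : ℝ) ^ 2 * L * L) ^ i
          * ∑ y, (tdistT (fine N M) x y / (N : ℝ)) ^ ε * Real.exp (-(δ₁ * (tdistT (fine N M) x y * (L : ℝ) ^ i / (N : ℝ)))) :=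
          Finset.sum_congr rfl fun i _ => by rw [Finset.mul_sum]
      _ ≤ ∑ i ∈ Finset.range K, A₁ * (N : ℝ) ^ (d + 1) * θ ^ i := Finset.sum_le_sum hlevel
      _ = A₁ * (N : ℝ) ^ (d + 1) * ∑ i ∈ Finset.range K, θ ^ i := by rw [Finset.mul_sum]
      _ ≤ A₁ * (N : ℝ) ^ (d + 1) * (1 / (1 - θ)) := mul_le_mul_of_nonneg_left hgeom (by positivity)
  -- assemble
  calc |∑ y, c * DDk y * (lam y - lam x)| ≤ ∑ y, |c * DDk y * (lam y - lam x)| := Finset.abs_sum_le_sum_abs _ _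
    _ ≤ ∑ y, c * C₀ * H * Real.exp (-(δ₀ * D₀)) * ((tdistT (fine N M) x y / (N : ℝ)) ^ ε * S₁ y) :=
        Finset.sum_le_sum fun y _ => hterm y
    _ = c * C₀ * H * Real.exp (-(δ₀ * D₀)) * ∑ y, (tdistT (fine N M) x y / (N : ℝ)) ^ ε * S₁ y := by rw [Finset.mul_sum]
    _ ≤ c * C₀ * H * Real.exp (-(δ₀ * D₀)) * (A₁ * (N : ℝ) ^ (d + 1) * (1 / (1 - θ))) :=
        mul_le_mul_of_nonneg_left hΦsum (by positivity)
    _ = (c * (N : ℝ) ^ (d + 1)) * (C₀ * A₁ / (1 - θ)) * H * Real.exp (-(δ₀ * D₀)) := by ring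
    _ = C₀ * A₁ / (1 - θ) * H * Real.exp (-(δ₀ * D₀)) := by rw [hcN, one_mul]

end Summit.QuantumFields.YangMills.BalabanUVNodes.N15KingModelRung.Curved
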